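import Summits.CriticalPhenomena.SAWScalingLimit.Theorems.CriticalBubbleBound.Negative.CriticalBubbleBoundLatticeKernel

/-!
# Negative-side results for the crux `SAWTotalPositivity.CriticalBubbleBound` (stmt-CriticalPhenomena-7117):
dihedral symmetry: all four critical bubbles coincide, `CriticalBubbleBound ⟺ G_{x_c}(0,e₀) < ∞` (work-file §10).

Refuter `cdisprove` (standing adversary); the full indexed work file is
`Summits/CriticalPhenomena/SAWScalingLimit/Cruxes/CriticalBubbleBound/Disproof.lean`.
-/

noncomputable section

open MeasureTheory Filter Topology Set Function
open Literature.Probability.LatticeModels Literature.Probability.Percolation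
open Literature.Probability.RandomPlanarGeometry Literature.Probability.RandomPlanarGeometry.SAW
open Literature.Barriers.CriticalPhenomena.SupercriticalSAW
open scoped ENNReal NNReal BigOperators

namespace Summit.CriticalPhenomena.SAWScalingLimit.Theorems.CriticalBubbleBound.Negative

open Summit.CriticalPhenomena.SAWScalingLimit.Theses.SAWTotalPositivity (CriticalBubbleBound)

/-! ## §10 Dihedral symmetry: the crux is about ONE number `G_{x_c}(0,e₀)` -/

/-- The kernel does not decrease under a graph automorphism applied to both endpoints. [folklore] -/
theorem latticeKernel_le_map (x : ℝ) (φ : zdGraph 2 ≃g zdGraph 2) (u v : Site 2) :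
    latticeKernel x u v ≤ latticeKernel x (φ u) (φ v) := by
  let F : LatticeSAW u v → LatticeSAW (φ u) (φ v) := fun p =>
    ⟨p.1.map φ.toHom, p.2.map φ.injective⟩
  have hF : Injective F := by
    rintro ⟨p, hp⟩ ⟨q, hq⟩ h
    have h' := congrArg Subtype.val h
    exact Subtype.ext (SimpleGraph.Walk.map_injective_of_injective φ.injective u v h')
  have key : (fun p : LatticeSAW u v => ENNReal.ofReal (x ^ p.1.length)) =
      fun p => (fun q : LatticeSAW (φ u) (φ v) => ENNReal.ofReal (x ^ q.1.length)) (F p) := by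
    funext p
    exact congrArg (fun n : ℕ => ENNReal.ofReal (x ^ n)) (SimpleGraph.Walk.length_map _ _).symm
  calc latticeKernel x u v
      = ∑' p : LatticeSAW u v, (fun q : LatticeSAW (φ u) (φ v) => ENNReal.ofReal (x ^ q.1.length)) (F p) := by
        rw [latticeKernel, key]
    _ ≤ latticeKernel x (φ u) (φ v) := ENNReal.tsum_comp_le_tsum_of_injective hF _

/-- **Invariance** of the kernel under the automorphisms of `ℤ²`. [folklore] -/
theorem latticeKernel_map (x : ℝ) (φ : zdGraph 2 ≃g zdGraph 2) (u v : Site 2) :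
    latticeKernel x (φ u) (φ v) = latticeKernel x u v := by
  refine le_antisymm ?_ (latticeKernel_le_map x φ u v)
  simpa using latticeKernel_le_map x φ.symm (φ u) (φ v)

/-- Central symmetry `x ↦ -x` of `ℤ²`. [folklore] -/
def negIso : zdGraph 2 ≃g zdGraph 2 where
  toEquiv := Equiv.neg (Site 2)
  map_rel_iff' := Zd.zdGraph_adj_neg _ _

/-- The coordinate swap `(a, b) ↦ (b, a)`. [folklore] -/
def swapSite (x : Site 2) : Site 2 := ![x 1, x 0]

/-- The swap is an involution. [folklore] -/
@[simp] theorem swapSite_swapSite (x : Site 2) : swapSite (swapSite x) = x := by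
  funext i; fin_cases i <;> rfl

/-- The swap preserves adjacency. [folklore] -/
theorem zdGraph_adj_swapSite {x y : Site 2} (h : (zdGraph 2).Adj x y) :
    (zdGraph 2).Adj (swapSite x) (swapSite y) := by
  rw [zdGraph_adj_iff] at h ⊢
  obtain ⟨i, h | h⟩ := h
  · subst h
    fin_cases i
    · exact ⟨1, Or.inl (by funext j; fin_cases j <;> simp [swapSite])⟩
    · exact ⟨0, Or.inl (by funext j; fin_cases j <;> simp [swapSite])⟩
  · subst h
    fin_cases i
    · exact ⟨1, Or.inr (by funext j; fin_cases j <;> simp [swapSite])⟩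
    · exact ⟨0, Or.inr (by funext j; fin_cases j <;> simp [swapSite])⟩

/-- The coordinate swap as an automorphism of `ℤ²`. [folklore] -/
def swapIso : zdGraph 2 ≃g zdGraph 2 where
  toEquiv := ⟨swapSite, swapSite, swapSite_swapSite, swapSite_swapSite⟩
  map_rel_iff' := by
    intro a b
    refine ⟨fun h => ?_, zdGraph_adj_swapSite⟩
    simpa using zdGraph_adj_swapSite h

/-- **All four critical bubbles coincide**: `G_{x_c}(0,e) = G_{x_c}(0,e₀)` for every unit vector `e`
(dihedral symmetry of `ℤ²`). [folklore] -/
theorem bubble_eq_bubble_e₀ {e : Site 2} (he : (zdGraph 2).Adj 0 e) : bubble e = bubble e₀ := by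
  have hneg : ∀ w : Site 2, bubble (-w) = bubble w := fun w => by
    have h := latticeKernel_map criticalFugacity negIso 0 w
    simp only [negIso] at h
    exact h
  have hswap : ∀ w : Site 2, bubble (swapSite w) = bubble w := fun w => by
    have h := latticeKernel_map criticalFugacity swapIso 0 w
    have h0 : swapIso 0 = 0 := by funext j; fin_cases j <;> rfl
    rw [h0] at h
    exact h
  have he₁ : swapSite e₀ = Pi.single 1 1 := by
    funext j; fin_cases j <;> simp [swapSite, e₀]
  have he₀ : (Pi.single 0 1 : Site 2) = e₀ := by
    funext j; fin_cases j <;> simp [e₀]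
  obtain ⟨i, hi | hi⟩ := (zdGraph_adj_iff _ _).1 he
  · rw [zero_add] at hi; subst hi
    fin_cases i
    · simp [he₀]
    · rw [Fin.mk_one, ← he₁, hswap]
  · have : e = -Pi.single i 1 := eq_neg_of_add_eq_zero_left hi.symm
    subst this
    rw [hneg]
    fin_cases i
    · simp [he₀]
    · rw [Fin.mk_one, ← he₁, hswap]

/-- **SINGLE-NUMBER NORMAL FORM.** `CriticalBubbleBound ⟺ G_{x_c}(0,e₀) < ∞`, with
`G_{x_c}(0,e₀) = Σ_n c_n(0,e₀) x_c^n = x_c + Σ_{m≥4} (m/2) p_m x_c^{m-1}`. [cite: MadrasSlade1993, §1.4] -/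
theorem criticalBubbleBound_iff_bubble_e₀_ne_top : CriticalBubbleBound ↔ bubble e₀ ≠ ⊤ := by
  rw [criticalBubbleBound_iff_bubble_ne_top]
  exact ⟨fun h => h e₀ adj_zero_e₀, fun h e he => by rwa [bubble_eq_bubble_e₀ he]⟩

end Summit.CriticalPhenomena.SAWScalingLimit.Theorems.CriticalBubbleBound.Negative
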